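import Mathlib
import HarnessLib
import Summits.HubbardSuperconductivity.HubbardSuperconductivity.Theorems.KLProgrammeKLRegimeSplitPairVariationDefs
import Summits.HubbardSuperconductivity.HubbardSuperconductivity.Theorems.KLProgrammeSWaveCascadeClosedForm

/-!
# Route `KLProgramme` — crux K3 gen 8, CHILD 1 (stmt-HubbardSuperconductivity-20438): the (B1-V) comparison sequence in CLOSED FORM —
# `PairVariationAtV17F.exists_closedForm`: `u_j(Qm) = U/(1 + U·Σ_{i<j} W_i(Qm))` for every `j ≤ n`

Cell gate-hubbard-kl, seat hubbard-kl-k3c1-p1 (g19; child-1 lineage; technique «composed-map remainder propagation»).  Door on the name `PairVariationAtV17F`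
(`…SplitPairVariationDefs`, p704193; pen g25 (R386)(A)) through the scalar closed form `sWaveFloor_eq_div` (`…SWaveCascadeClosedForm`, p704335): the package's law
`u (i+1) = u i/(1 + W i·u i)`, its mass bounds `|W i| ≤ m i` and its negative-mass line `16·U·Σ_{i<n}(m i − W i) ≤ 1` are exactly the floor hypotheses with
`ν i := m i − W i`, so the witness is EXPLICIT — **`PairVariationAtV17F.exists_closedForm`**: for every `Qm` the package's witnesses `u, W, m` satisfy, in addition to every
(B1-V) clause, `0 < 1 + U·Σ_{i<j} W i` and `u j = U/(1 + U·Σ_{i<j} W i)` for all `j ≤ n` (so `u` is determined by the partial sums of the signed ladder net masses; with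
`sWaveFloor_sub_le'` two transfers' sequences differ by at most `(16U/15)²·Σ_{i<j}|W i(Qm) − W i(Qm′)|` once the producer names its weights — k3c2-p3's (T2)/(s2)).
Bookkeeping only; nothing about the model is asserted; nothing asserts superconductivity.  Everything is proved; no definitions.
-/

noncomputable section

namespace Summit.HubbardSuperconductivity.HubbardSuperconductivity.Theorems.KLRegimeSplit

set_option linter.dupNamespace false -- summit = problem name (single-conjunct summit), D-0017

open Real Finset Literature.MathematicalPhysics.QuantumLattice Literature.Probability.LatticeModels
open Summit.HubbardSuperconductivity.HubbardSuperconductivity.Theorems.KLProgrammeLegKernels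
open Summit.HubbardSuperconductivity.HubbardSuperconductivity.Theorems.CooperChannelRiccatiFlow
open Summit.HubbardSuperconductivity.HubbardSuperconductivity.Theorems.SWaveCascade

section Model

variable {L M : ℕ} [NeZero L] [NeZero M]

/-- **The (B1-V) witness in closed form.**  From `PairVariationAtV17F … n`: for every total momentum the witnesses `u, W, m` of the package satisfy every (B1-V) clause
AND `0 < 1 + U·Σ_{i<j} W i`, `u j = U/(1 + U·Σ_{i<j} W i)` for all `j ≤ n`. -/
theorem PairVariationAtV17F.exists_closedForm {G : GeoConsts} {P : SplitConsts} {Q : EngConsts} {β U μ : ℝ} {n : ℕ}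
    (h : PairVariationAtV17F L M G P Q β U μ n) (Qm : TorusSite 2 L) :
    ∃ u W m : ℕ → ℝ, u 0 = U ∧ (∀ i, u (i + 1) = u i / (1 + W i * u i)) ∧
      (∀ i, |W i| ≤ m i ∧ m i ≤ G.bhi) ∧
      (∀ i < n, IsPairClassAt L Qm (i + 1) → m i - W i ≤ 2 * klEdge G (i + 1) (klTorusNorm L Qm)) ∧
      (∀ i, (n ≤ i ∨ ¬ IsPairClassAt L Qm (i + 1)) → W i = 0 ∧ m i = 0) ∧
      16 * U * ∑ i ∈ range n, (m i - W i) ≤ 1 ∧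
      (∀ i j, i ≤ j → j ≤ n → u j ≤ u i + (16 / 15 * U) ^ 2 * ∑ l ∈ Ico i j, (m l - W l)) ∧
      ∑ i ∈ range n, |u (i + 1) - u i| ≤ 257 / 225 * U ∧
      (∀ j ≤ n, 0 ≤ u j ∧ u j ≤ 2 * |U| ∧ ∀ k ∈ klBall L μ 0, ∀ k' ∈ klBall L μ 0,
        ‖klPairAmplitude L M β U μ (klFlowFrameU L M β U μ j) j Qm k k' - (u j : ℂ)‖ ≤ (P.C_W + klLegKappa * Q.CR * P.Klam ^ 3) * U ^ 2) ∧
      (∀ k ∈ klBall L μ 0, ∀ k' ∈ klBall L μ 0,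
        ∑ i ∈ range n, ‖klPairAmplitude L M β U μ (klFlowFrameU L M β U μ (i + 1)) (i + 1) Qm k k' -
            klPairAmplitude L M β U μ (klFlowFrameU L M β U μ i) i Qm k k'‖ ≤
          11 / 9 * U + (P.C_W + klLegKappa * Q.CR * P.Klam ^ 3) * U ^ 2) ∧
      ∀ j ≤ n, 0 < 1 + U * ∑ i ∈ range j, W i ∧ u j = U / (1 + U * ∑ i ∈ range j, W i) := by
  obtain ⟨u, W, m, hu0, hlaw, hWm, hdef, hzero, hnegm, hqm, htv, henv, htvA⟩ := h Qm
  have hu0' : 0 ≤ u 0 := (henv 0 (Nat.zero_le n)).1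
  have hWν : ∀ i, -(m i - W i) ≤ W i := fun i => by linarith [(hWm i).1, abs_nonneg (W i)]
  have hν0 : ∀ i, 0 ≤ m i - W i := fun i => by linarith [(hWm i).1, le_abs_self (W i)]
  have hnegm' : 16 * u 0 * ∑ i ∈ range n, (m i - W i) ≤ 1 := by rw [hu0]; exact hnegm
  have hcf := sWaveFloor_eq_div (U := u) (W := W) (ν := fun i => m i - W i) (N := n) hu0' hlaw hWν hν0 hnegm'
  rw [hu0] at hcf
  exact ⟨u, W, m, hu0, hlaw, hWm, hdef, hzero, hnegm, hqm, htv, henv, htvA, hcf⟩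

end Model

end Summit.HubbardSuperconductivity.HubbardSuperconductivity.Theorems.KLRegimeSplit

end
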